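import Literature.NumberTheory.DiophantineGeometry.FibreConductorBadPlaces
import HarnessLib

/-!
# `ord_w` bookkeeping for the defect form of [GenEll] Thm 2.1's conductor inequality on `D_e`

Support file (proof-only, no definitions) for the abc-iut cell's route item `GenEllTwo`
(stmt-ABC-19679; [GenEll] = S. Mochizuki, *Arithmetic elliptic curves in general position*, Math. J.
Okayama Univ. **52** (2010), Thm. 2.1 (ii) ⇒ (i), proof pp. 12–13; package W5 «sharp Prop. 1.6 on the
curve `D_e`», piece (F-b) of the cell's R-b-with-defects resolution).  Classical and undisputed; nothing
here bears on [IUTchIII] Cor. 3.12.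

Elementary additive-ultrametric bookkeeping for the normalised order `ord_w` of the tree
(`Literature.IUT.LogVolume.ord`) at a finite place `w` of a number field `L`, uniform in `L` through the
ramification index `e(w∣p) = ramIdx L w`:
* strict / non-strict ultrametric inequalities for sums, products, finite sums;
* `ord_w n ≤ n·e(w∣p)` for `n ∈ ℕ⁺`, `ord_w m = 0` for `p ∤ m`, `|ord_w y| ≤ |y|·e(w∣p)` for `y ∈ ℤ ∖ 0`;
* for a FIXED `α ∈ K` (a number field below `L`): `−|y|·e(w∣p) ≤ ord_w α ≤ |y'|·e(w∣p)` as soon as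
  `y·α`, `y'·α⁻¹` are integral — the only way the constants of the defect inequality depend on `α`;
* `ord_w P(r) ≥ −(d + deg P·R)·e(w∣p)` for a polynomial with coefficient orders `≥ −d·e` at a point with
  `|ord_w r| ≤ R·e`;
* the identity bound `ord_N_le_of_identity`: from `∏_{β∈A}(t − β)·(rs) = N·(H₀(r) + s·H₁(r))` at a
  point with pinned `ord_w r`, `ord_w s`, `ord_w N ≤ Σ_β ord⁺_w(t − β) + O(e(w∣p))`.
The curve-specific part (pinning of `ord_w r`, `ord_w s` on `D_e`) and the consumer-facing theorem are
in `GenEllDeBadPlaceDefect.lean`.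
[cite: BombieriGubler2006, §1.5] [cite: MochizukiGenEll2010, Thm 2.1 proof pp.12-13]
-/

noncomputable section

open NumberField IsDedekindDomain Polynomial Finset
open Literature.IUT.LogVolume Literature.IUT.LogVolume.Cor22

namespace Literature.NumberTheory.DiophantineGeometry.GenEll

namespace DeDefect

variable {L : Type*} [Field L] [NumberField L] (w : HeightOneSpectrum (𝓞 L))

/-! ## `ord_w` bookkeeping (additive ultrametric inequalities) -/

/-- `ord_w(−x) = ord_w(x)`. [cite: BombieriGubler2006, §1.5] -/
theorem ord_neg (x : L) : ord L w (-x) = ord L w x := by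
  unfold ord; rw [Valuation.map_neg]

/-- Strict ultrametric equality: `ord_w x < ord_w y ⇒ ord_w (x + y) = ord_w x` (for `x, y ≠ 0`).
[cite: BombieriGubler2006, §1.5] -/
theorem ord_add_eq_of_lt {x y : L} (hx : x ≠ 0) (hy : y ≠ 0) (h : ord L w x < ord L w y) :
    ord L w (x + y) = ord L w x := by
  have hvx : w.valuation L x ≠ 0 := (w.valuation L).ne_zero_iff.mpr hx
  have hvy : w.valuation L y ≠ 0 := (w.valuation L).ne_zero_iff.mpr hy
  have hv : w.valuation L y < w.valuation L x := by
    unfold ord at h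
    exact (WithZero.log_lt_log hvy hvx).1 (by omega)
  unfold ord
  rw [Valuation.map_add_eq_of_lt_left _ hv]

/-- Ultrametric inequality: `min (ord_w x) (ord_w y) ≤ ord_w (x + y)` (for `x, y, x + y ≠ 0`).
[cite: BombieriGubler2006, §1.5] -/
theorem min_ord_le_ord_add {x y : L} (hx : x ≠ 0) (hy : y ≠ 0) (hxy : x + y ≠ 0) :
    min (ord L w x) (ord L w y) ≤ ord L w (x + y) := by
  have hvx : w.valuation L x ≠ 0 := (w.valuation L).ne_zero_iff.mpr hx
  have hvy : w.valuation L y ≠ 0 := (w.valuation L).ne_zero_iff.mpr hy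
  have hvxy : w.valuation L (x + y) ≠ 0 := (w.valuation L).ne_zero_iff.mpr hxy
  have hle : w.valuation L (x + y) ≤ max (w.valuation L x) (w.valuation L y) :=
    Valuation.map_add _ _ _
  unfold ord
  rcases le_max_iff.1 hle with h | h
  · have := (WithZero.log_le_log hvxy hvx).2 h
    omega
  · have := (WithZero.log_le_log hvxy hvy).2 h
    omega

/-- Ultrametric inequality with a zero summand allowed on the left: if `y ≠ 0`, `x + y ≠ 0` and
`x = 0 ∨ m ≤ ord_w x`, `m ≤ ord_w y`, then `m ≤ ord_w (x + y)`. [cite: BombieriGubler2006, §1.5] -/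
theorem le_ord_add_of_le {x y : L} {m : ℤ} (hy : y ≠ 0) (hxy : x + y ≠ 0)
    (hx : x = 0 ∨ m ≤ ord L w x) (hym : m ≤ ord L w y) : m ≤ ord L w (x + y) := by
  rcases eq_or_ne x 0 with h0 | h0
  · rw [h0, zero_add]; exact hym
  · rcases hx with h | h
    · exact absurd h h0
    · exact (le_min h hym).trans (min_ord_le_ord_add w h0 hy hxy)

/-- Ultrametric inequality with either summand allowed to vanish: `x + y ≠ 0`, `x = 0 ∨ m ≤ ord_w x`,
`y = 0 ∨ m ≤ ord_w y` give `m ≤ ord_w (x + y)`. [cite: BombieriGubler2006, §1.5] -/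
theorem le_ord_add_of_le' {x y : L} {m : ℤ} (hxy : x + y ≠ 0)
    (hx : x = 0 ∨ m ≤ ord L w x) (hy : y = 0 ∨ m ≤ ord L w y) : m ≤ ord L w (x + y) := by
  rcases eq_or_ne y 0 with h0 | h0
  · rw [h0, add_zero] at hxy ⊢
    rcases hx with h | h
    · exact absurd h hxy
    · exact h
  · rcases hy with h | h
    · exact absurd h h0
    · exact le_ord_add_of_le w h0 hxy hx h

/-- Integral elements have nonnegative order. [cite: BombieriGubler2006, §1.5] -/
theorem ord_nonneg_of_isIntegral' {x : L} (hx : IsIntegral ℤ x) : 0 ≤ ord L w x := by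
  have h := ord_nonneg_of_isIntegral L w ⟨x, hx⟩
  exact h

/-- Natural numbers have nonnegative order. [cite: BombieriGubler2006, §1.5] -/
theorem ord_natCast_nonneg (n : ℕ) : 0 ≤ ord L w (n : L) := by
  have h := ord_nonneg_of_isIntegral L w (n : 𝓞 L)
  simpa using h

/-- The rational prime `p` lies in every place over it. [cite: BombieriGubler2006, §1.5] -/
theorem natCast_mem_of_mem_placesOver (p : ℕ) [Fact p.Prime] (hw : w ∈ placesOver L p) :
    (p : 𝓞 L) ∈ w.asIdeal := by
  have hL : w.asIdeal.LiesOver (Ideal.span {(p : ℤ)}) := (mem_placesOver_iff w).1 hw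
  have hmem : (p : ℤ) ∈ Ideal.span {(p : ℤ)} := Ideal.mem_span_singleton_self _
  rw [hL.over, Ideal.under_def, Ideal.mem_comap] at hmem
  simpa using hmem

/-- A natural number prime to `p` is a unit at every place over `p`: `ord_w m = 0`.
[cite: BombieriGubler2006, §1.5] -/
theorem ord_natCast_eq_zero_of_not_dvd (p : ℕ) [hp : Fact p.Prime] (hw : w ∈ placesOver L p)
    {m : ℕ} (hm : ¬ p ∣ m) : ord L w (m : L) = 0 := by
  have hm0 : m ≠ 0 := by rintro rfl; exact hm (dvd_zero p)
  have hcop : Nat.Coprime p m := (Nat.Prime.coprime_iff_not_dvd hp.out).2 hm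
  -- `m ∉ w`: otherwise `1 = a p + b m ∈ w`
  have hnot : (m : 𝓞 L) ∉ w.asIdeal := by
    intro hmem
    have hpm := natCast_mem_of_mem_placesOver w p hw
    obtain ⟨a, b, hab⟩ : ∃ a b : ℤ, a * p + b * m = 1 := by
      have := Nat.Coprime.isCoprime hcop
      obtain ⟨a, b, h⟩ := this
      exact ⟨a, b, by linarith⟩
    have h1 : (1 : 𝓞 L) ∈ w.asIdeal := by
      have e : (1 : 𝓞 L) = (a : 𝓞 L) * (p : 𝓞 L) + (b : 𝓞 L) * (m : 𝓞 L) := by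
        have := congrArg (fun z : ℤ => (z : 𝓞 L)) hab
        push_cast at this
        exact this.symm
      rw [e]
      exact w.asIdeal.add_mem (w.asIdeal.mul_mem_left _ hpm) (w.asIdeal.mul_mem_left _ hmem)
    exact w.isPrime.ne_top ((Ideal.eq_top_iff_one _).2 h1)
  have hne : (m : 𝓞 L) ≠ 0 := by exact_mod_cast hm0
  have hge : 0 ≤ ord L w (m : L) := ord_natCast_nonneg w m
  have hngt : ¬ 0 < ord L w ((m : 𝓞 L) : L) := fun h => hnot ((ord_pos_iff_mem L w (m : 𝓞 L) hne).1 h)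
  have : ((m : 𝓞 L) : L) = (m : L) := by simp
  rw [this] at hngt
  omega

/-- `ord_w n ≤ n · e(w∣p)` for a positive natural number `n` (crude uniform bound:
`n = p^a m`, `p ∤ m`, `a ≤ n`). [cite: BombieriGubler2006, §1.5] -/
theorem ord_natCast_le (p : ℕ) [hp : Fact p.Prime] (hw : w ∈ placesOver L p) {n : ℕ} (hn : n ≠ 0) :
    ord L w (n : L) ≤ n * ramIdx L w := by
  obtain ⟨a, m, hm, rfl⟩ := Nat.exists_eq_pow_mul_and_not_dvd hn p hp.out.one_lt.ne'
  have hm0 : m ≠ 0 := by rintro rfl; exact hm (dvd_zero p)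
  have hp0 : (p : L) ≠ 0 := by exact_mod_cast hp.out.ne_zero
  have hmL : (m : L) ≠ 0 := by exact_mod_cast hm0
  have hpa : ((p : L) ^ a) ≠ 0 := pow_ne_zero _ hp0
  have e1 : ((p ^ a * m : ℕ) : L) = (p : L) ^ a * (m : L) := by push_cast; ring
  rw [e1, ord_mul L w hpa hmL, ord_pow L w, ord_natCast_eq_zero_of_not_dvd w p hw hm,
    ord_natCast_eq_ramIdx p w hw]
  have ha : a ≤ p ^ a * m := by
    calc a ≤ p ^ a := (Nat.lt_pow_self hp.out.one_lt).le
      _ ≤ p ^ a * m := Nat.le_mul_of_pos_right _ (Nat.pos_of_ne_zero hm0)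
  have hE : (0 : ℤ) ≤ ramIdx L w := Nat.cast_nonneg _
  push_cast
  nlinarith

/-- `ord_w y ≤ |y| · e(w∣p)` for a nonzero integer `y`. [cite: BombieriGubler2006, §1.5] -/
theorem ord_intCast_le (p : ℕ) [Fact p.Prime] (hw : w ∈ placesOver L p) {y : ℤ} (hy : y ≠ 0) :
    ord L w (y : L) ≤ y.natAbs * ramIdx L w := by
  have hn : y.natAbs ≠ 0 := Int.natAbs_ne_zero.mpr hy
  have h := ord_natCast_le w p hw hn
  rcases Int.natAbs_eq y with e | e
  · have : (y : L) = (y.natAbs : L) := by rw [e]; simp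
    rw [this]; exact h
  · have : (y : L) = -(y.natAbs : L) := by
      conv_lhs => rw [e]
      simp only [Int.cast_neg, Int.cast_natCast]
    rw [this, ord_neg]; exact h

/-- Lower bound for the order of a fixed nonzero `α ∈ K`, uniformly over all extensions `L ⊇ K` and all
places `w ∣ p`: if `y·α` is integral (`y ∈ ℤ ∖ 0`), then `−|y|·e(w∣p) ≤ ord_w α`.
[cite: BombieriGubler2006, §1.5] -/
theorem neg_le_ord_algebraMap {K : Type*} [Field K] [NumberField K] [Algebra K L] (p : ℕ)
    [Fact p.Prime] (hw : w ∈ placesOver L p) {α : K} (hα : α ≠ 0) {y : ℤ} (hy : y ≠ 0)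
    (h : IsIntegral ℤ ((y : K) * α)) :
    -(y.natAbs * ramIdx L w : ℤ) ≤ ord L w (algebraMap K L α) := by
  have hαL : algebraMap K L α ≠ 0 := (_root_.map_ne_zero _).2 hα
  have hyL : (y : L) ≠ 0 := by exact_mod_cast hy
  have i₁ : IsIntegral ℤ ((y : L) * algebraMap K L α) := by
    have := h.map (IsScalarTower.toAlgHom ℤ K L)
    simpa using this
  have o₁ := ord_nonneg_of_isIntegral' w i₁
  rw [ord_mul L w hyL hαL] at o₁
  have b₁ := ord_intCast_le w p hw hy
  linarith

/-- Upper bound for the order of a fixed nonzero `α ∈ K`: if `y·α⁻¹` is integral (`y ∈ ℤ ∖ 0`), then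
`ord_w α ≤ |y|·e(w∣p)`. [cite: BombieriGubler2006, §1.5] -/
theorem ord_algebraMap_le {K : Type*} [Field K] [NumberField K] [Algebra K L] (p : ℕ)
    [Fact p.Prime] (hw : w ∈ placesOver L p) {α : K} (hα : α ≠ 0) {y : ℤ} (hy : y ≠ 0)
    (h : IsIntegral ℤ ((y : K) * α⁻¹)) :
    ord L w (algebraMap K L α) ≤ y.natAbs * ramIdx L w := by
  have hαL : algebraMap K L α ≠ 0 := (_root_.map_ne_zero _).2 hα
  have hyL : (y : L) ≠ 0 := by exact_mod_cast hy
  have i₂ : IsIntegral ℤ ((y : L) * (algebraMap K L α)⁻¹) := by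
    have := h.map (IsScalarTower.toAlgHom ℤ K L)
    simpa using this
  have o₂ := ord_nonneg_of_isIntegral' w i₂
  rw [ord_mul L w hyL (inv_ne_zero hαL), ord_inv L w] at o₂
  have b₂ := ord_intCast_le w p hw hy
  linarith

/-- Ultrametric inequality for a finite sum: if every nonzero summand has `m ≤ ord_w`, and the sum is
nonzero, then `m ≤ ord_w (Σ)`. [cite: BombieriGubler2006, §1.5] -/
theorem le_ord_sum {ι : Type*} (S : Finset ι) (f : ι → L) {m : ℤ}
    (hf : ∀ i ∈ S, f i ≠ 0 → m ≤ ord L w (f i)) (hS : ∑ i ∈ S, f i ≠ 0) :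
    m ≤ ord L w (∑ i ∈ S, f i) := by
  classical
  induction S using Finset.induction_on with
  | empty => simp at hS
  | insert a S ha ih =>
    rw [Finset.sum_insert ha] at hS ⊢
    by_cases hsum : ∑ i ∈ S, f i = 0
    · rw [hsum, add_zero] at hS ⊢
      exact hf a (Finset.mem_insert_self a S) hS
    · have ih' := ih (fun i hi => hf i (Finset.mem_insert_of_mem hi)) hsum
      refine le_ord_add_of_le w hsum hS ?_ ih'
      by_cases hfa : f a = 0
      · exact Or.inl hfa
      · exact Or.inr (hf a (Finset.mem_insert_self a S) hfa)

/-- `ord_w` of a finite product of nonzero elements is the sum of the orders.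
[cite: BombieriGubler2006, §1.5] -/
theorem ord_prod {ι : Type*} (S : Finset ι) (f : ι → L) (hf : ∀ i ∈ S, f i ≠ 0) :
    ord L w (∏ i ∈ S, f i) = ∑ i ∈ S, ord L w (f i) := by
  classical
  induction S using Finset.induction_on with
  | empty => simp [ord_one]
  | insert a S ha ih =>
    rw [Finset.prod_insert ha, Finset.sum_insert ha,
      ord_mul L w (hf a (Finset.mem_insert_self a S))
        (Finset.prod_ne_zero_iff.2 fun i hi => hf i (Finset.mem_insert_of_mem hi)),
      ih fun i hi => hf i (Finset.mem_insert_of_mem hi)]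

/-- Lower bound for the order of a polynomial value: if every nonzero coefficient `α` of `P` satisfies
`−dE ≤ ord_w α`, and `r = 0` or `−R·E ≤ ord_w r` (`E, R, d ≥ 0`), then `−(d + deg P · R)·E ≤ ord_w P(r)`
whenever `P(r) ≠ 0`. [cite: BombieriGubler2006, §1.5] -/
theorem le_ord_aeval {P : L[X]} {r : L} {d R E : ℤ} (hE : 0 ≤ E) (hR : 0 ≤ R)
    (hcoeff : ∀ n, P.coeff n ≠ 0 → -(d * E) ≤ ord L w (P.coeff n))
    (hr : r = 0 ∨ -(R * E) ≤ ord L w r) (hP : aeval r P ≠ 0) :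
    -((d + P.natDegree * R) * E) ≤ ord L w (aeval r P) := by
  rw [aeval_eq_sum_range] at hP ⊢
  refine le_ord_sum w _ _ (fun n hn hne => ?_) hP
  have hn' : n ≤ P.natDegree := Nat.lt_succ_iff.mp (Finset.mem_range.mp hn)
  have hcn : P.coeff n ≠ 0 := by
    intro h; apply hne; simp [h]
  have hdeg : (n : ℤ) * (R * E) ≤ P.natDegree * R * E := by
    have : (n : ℤ) ≤ P.natDegree := by exact_mod_cast hn'
    nlinarith [mul_nonneg hR hE]
  rcases eq_or_ne r 0 with h0 | h0
  · -- then only `n = 0` survives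
    have hn0 : n = 0 := by
      by_contra hne0
      apply hne
      simp [h0, zero_pow hne0]
    subst hn0
    simp only [pow_zero, smul_eq_mul, mul_one]
    have := hcoeff 0 hcn
    nlinarith [mul_nonneg (mul_nonneg (Nat.cast_nonneg P.natDegree) hR) hE]
  · rcases hr with h | h
    · exact absurd h h0
    · have hrn : r ^ n ≠ 0 := pow_ne_zero _ h0
      rw [smul_eq_mul, ord_mul L w hcn hrn, ord_pow L w]
      have h1 := hcoeff n hcn
      have h2 : -(R * E) * n ≤ n * ord L w r := by nlinarith
      nlinarith

/-! ## The identity bound in the pinned region -/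

/-- **The ramification identity at a pinned point.**  If `∏_{β∈A}(s + c r^{k+2} − β·rs) = N·H` with
`H = H₀(r) + s·H₁(r)`, `t·(rs) = s + c·r^{k+2}`, `t ∉ A`, `rs ≠ 0`, and the orders of `r`, `s` and of
the coefficients of `H₀`, `H₁` are bounded (`|ord r| ≤ R·E`, `−Sm·E ≤ ord s ≤ Sx·E`,
coefficients `≥ −dH·E`), then
`ord_w N ≤ Σ_{β∈A} ord⁺_w(t − β) + (|A|·(R + Sx) + dH + (deg H₀ + deg H₁)·R + Sm)·E`.
[cite: MochizukiGenEll2010, Thm 2.1 proof pp.12-13] -/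
theorem ord_N_le_of_identity {K : Type*} [Field K] [Algebra K L] (k : ℕ) {c r s t N : L}
    (A : Finset K) (H₀ H₁ : L[X]) {R Sm Sx dH E : ℤ} (hE : 0 ≤ E) (hR : 0 ≤ R) (hSm : 0 ≤ Sm)
    (ht : t * (r * s) = s + c * r ^ (k + 2)) (hr : r ≠ 0) (hs : s ≠ 0)
    (hN0 : N ≠ 0) (htA : ∀ β ∈ A, t ≠ algebraMap K L β)
    (hH : ∏ β ∈ A, (s + c * r ^ (k + 2) - algebraMap K L β * (r * s)) =
      N * (aeval r H₀ + s * aeval r H₁))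
    (hρl : -(R * E) ≤ ord L w r) (hρu : ord L w r ≤ R * E)
    (hσl : -(Sm * E) ≤ ord L w s) (hσu : ord L w s ≤ Sx * E)
    (hc₀ : ∀ n, H₀.coeff n ≠ 0 → -(dH * E) ≤ ord L w (H₀.coeff n))
    (hc₁ : ∀ n, H₁.coeff n ≠ 0 → -(dH * E) ≤ ord L w (H₁.coeff n)) :
    ord L w N ≤ (∑ β ∈ A, ((ord L w (t - algebraMap K L β)).toNat : ℤ)) +
      (A.card * (R + Sx) + dH + (H₀.natDegree + H₁.natDegree) * R + Sm) * E := by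
  have hrs : r * s ≠ 0 := mul_ne_zero hr hs
  -- each factor is `(t − β)·(rs)`
  have hfac : ∀ β ∈ A, s + c * r ^ (k + 2) - algebraMap K L β * (r * s) =
      (t - algebraMap K L β) * (r * s) := by
    intro β _; linear_combination -ht
  have hne : ∀ β ∈ A, (t - algebraMap K L β) * (r * s) ≠ 0 := fun β hβ =>
    mul_ne_zero (sub_ne_zero.2 (htA β hβ)) hrs
  have hprod : ∏ β ∈ A, (s + c * r ^ (k + 2) - algebraMap K L β * (r * s)) =
      ∏ β ∈ A, (t - algebraMap K L β) * (r * s) := Finset.prod_congr rfl hfac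
  have hD0 : ∏ β ∈ A, (t - algebraMap K L β) * (r * s) ≠ 0 :=
    Finset.prod_ne_zero_iff.2 hne
  set H : L := aeval r H₀ + s * aeval r H₁ with hHdef
  have hH0 : H ≠ 0 := by
    intro h0; apply hD0; rw [← hprod, hH, h0, mul_zero]
  -- `ord 𝒟 = Σ (ord (t−β) + ord r + ord s)`
  have hordD : ord L w (∏ β ∈ A, (t - algebraMap K L β) * (r * s)) =
      ∑ β ∈ A, (ord L w (t - algebraMap K L β) + (ord L w r + ord L w s)) := by
    rw [ord_prod w A _ hne]
    refine Finset.sum_congr rfl fun β hβ => ?_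
    rw [ord_mul L w (sub_ne_zero.2 (htA β hβ)) hrs, ord_mul L w hr hs]
  -- `ord H ≥ −(dH + (deg₀+deg₁)R + Sm)E`
  have hH_lower : -((dH + (H₀.natDegree + H₁.natDegree) * R + Sm) * E) ≤ ord L w H := by
    have hdeg₀ : (0 : ℤ) ≤ H₀.natDegree := Nat.cast_nonneg _
    have hdeg₁ : (0 : ℤ) ≤ H₁.natDegree := Nat.cast_nonneg _
    refine le_ord_add_of_le' w (by rw [← hHdef]; exact hH0) ?_ ?_
    · rcases eq_or_ne (aeval r H₀) 0 with h0 | h0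
      · exact Or.inl h0
      · right
        have h := le_ord_aeval w (P := H₀) hE hR hc₀ (Or.inr hρl) h0
        nlinarith [mul_nonneg hdeg₁ hR, mul_nonneg hSm hE, mul_nonneg (mul_nonneg hdeg₁ hR) hE]
    · rcases eq_or_ne (aeval r H₁) 0 with h1 | h1
      · left; rw [h1, mul_zero]
      · right
        have h := le_ord_aeval w (P := H₁) hE hR hc₁ (Or.inr hρl) h1
        rw [ord_mul L w hs h1]
        nlinarith [mul_nonneg hdeg₀ hR, mul_nonneg (mul_nonneg hdeg₀ hR) hE]
  -- `ord N = ord 𝒟 − ord H`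
  have hNH : ord L w N = ord L w (∏ β ∈ A, (t - algebraMap K L β) * (r * s)) - ord L w H := by
    have := congrArg (ord L w) hH
    rw [hprod, ord_mul L w hN0 hH0] at this
    linarith
  -- bound the sum
  have hsum : ∑ β ∈ A, (ord L w (t - algebraMap K L β) + (ord L w r + ord L w s)) ≤
      (∑ β ∈ A, ((ord L w (t - algebraMap K L β)).toNat : ℤ)) + A.card * (R + Sx) * E := by
    rw [Finset.sum_add_distrib, Finset.sum_const, nsmul_eq_mul]
    have h1 : ∑ β ∈ A, ord L w (t - algebraMap K L β) ≤
        ∑ β ∈ A, ((ord L w (t - algebraMap K L β)).toNat : ℤ) :=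
      Finset.sum_le_sum fun β _ => Int.self_le_toNat _
    have h2 : (A.card : ℤ) * (ord L w r + ord L w s) ≤ A.card * ((R + Sx) * E) :=
      mul_le_mul_of_nonneg_left (by nlinarith) (Nat.cast_nonneg _)
    nlinarith
  rw [hNH, hordD]
  nlinarith

end DeDefect

end Literature.NumberTheory.DiophantineGeometry.GenEll
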